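import Literature.Computability.AlgebraicComplexity.NewtonPolygonTauTransfer
import HarnessLib

/-!
# Solo seat (blind) — a kernel-checked witness for KPTT problem 1: `Newt(fg + 1)` can have `2t + 2` vertices

Koiran–Portier–Tavenas–Thomassé (FoCM 2015, arXiv:1308.2286, §5 problem 1) ask whether the Newton
polygon of `fg + 1` has `O(t)` vertices when `f, g ∈ ℂ[X, Y]` have `t` monomials each (known:
`O(t^{4/3})`, their Thm. 5).  Without cancellation `Newt(fg + 1) = conv(Newt(fg) ∪ {0})` has at most
`2t + 1` vertices, and `2t + 1` is the natural sharp guess.  This file REFUTES that guess in the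
kernel: for `t = 4`,

  `f = 1 + XY + XY⁴ - Y⁷`,  `g = -1 + XY - X³Y + X⁷`,
  `fg + 1 = Y⁷ - XY⁴ - XY⁸ + X²Y² + X²Y⁵ - X³Y + X³Y⁸ - X⁴Y² - X⁴Y⁵ + X⁷ - X⁷Y⁷ + X⁸Y + X⁸Y⁴`,

and `Newt(fg + 1)` has the ten vertices `(0,7),(1,4),(2,2),(3,1),(7,0),(8,1),(8,4),(7,7),(3,8),(1,8)`
(`10 = 2t + 2`).  Mechanism: the shared monomial `XY` cancels in `fg + 1` (as does the constant) but
still feeds the outer vertices `(8,1) = (7,0)+(1,1)`, `(1,8) = (0,7)+(1,1)`, while its square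
`X²Y² = XY·XY` survives as an extra inner vertex.  The solo seat's searches (`t ≤ 8`) found nothing
beyond `2t + 2`; the `O(t)` form is `FgPlusOneLinear` in `SoloBlindNewtonRungs.lean`.

Contents: the naive form `FgPlusOneTwoTAddOne` as an obligation node and its refutation
`not_fgPlusOneTwoTAddOne`; the vertex count is certified by strict integer separating functionals
(`KPTT.mem_extremePoints_convexHull_of_linear`), the supports by coefficient computation.

References: KPTT 2015 [KoiranPortierTavenasThomasse2015, §5 and App. Thm. 7].
-/

open MvPolynomial

noncomputable section

set_option linter.dupNamespace false

namespace Summit.ValiantsHypothesis.ValiantsHypothesis.Theorems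

open Literature.Computability.AlgebraicComplexity
open Literature.Computability.AlgebraicComplexity.KPTT (toPt mem_extremePoints_convexHull_of_linear)

/-- The exponent vector `(a, b) ∈ ℕ²` of the monomial `X^a Y^b`. [folklore] -/
def ex (a b : ℕ) : Fin 2 →₀ ℕ := Finsupp.single 0 a + Finsupp.single 1 b

/-- Every exponent vector of `Fin 2` is of the form `ex a b`. [folklore] -/
theorem ex_eta (m : Fin 2 →₀ ℕ) : ex (m 0) (m 1) = m := by
  ext i; fin_cases i <;> simp [ex]

/-- `ex` is injective (oriented for rewriting `coeff_monomial` conditions). [folklore] -/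
theorem ex_eq_iff {a b c d : ℕ} : ex c d = ex a b ↔ a = c ∧ b = d := by
  constructor
  · intro h
    exact ⟨by simpa [ex] using (congrArg (fun m => m 0) h).symm, by simpa [ex] using (congrArg (fun m => m 1) h).symm⟩
  · rintro ⟨rfl, rfl⟩; rfl

/-- First real coordinate of the point of `ex a b`. [folklore] -/
@[simp] theorem toPt_ex_zero (a b : ℕ) : toPt (ex a b) 0 = a := by simp [toPt, ex]
/-- Second real coordinate of the point of `ex a b`. [folklore] -/
@[simp] theorem toPt_ex_one (a b : ℕ) : toPt (ex a b) 1 = b := by simp [toPt, ex]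

/-- The monomial `X^a Y^b ∈ ℂ[X, Y]`. [folklore] -/
def mono (a b : ℕ) : MvPolynomial (Fin 2) ℂ := X 0 ^ a * X 1 ^ b

/-- `mono a b` is the monomial with exponent `ex a b` and coefficient `1`. [folklore] -/
theorem mono_eq (a b : ℕ) : mono a b = monomial (ex a b) 1 := by
  rw [mono, X_pow_eq_monomial, X_pow_eq_monomial, monomial_mul, one_mul]; rfl

/-- The witness `f = 1 + XY + XY⁴ - Y⁷` (`t = 4` monomials). [folklore] -/
def wf : MvPolynomial (Fin 2) ℂ := mono 0 0 + mono 1 1 + mono 1 4 - mono 0 7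
/-- The witness `g = -1 + XY - X³Y + X⁷` (`t = 4` monomials). [folklore] -/
def wg : MvPolynomial (Fin 2) ℂ := -mono 0 0 + mono 1 1 - mono 3 1 + mono 7 0
/-- `fg + 1`, expanded: 13 monomials (the constant and the `XY` terms cancel). [folklore] -/
def wT : MvPolynomial (Fin 2) ℂ :=
  mono 0 7 - mono 1 4 - mono 1 8 + mono 2 2 + mono 2 5 - mono 3 1 + mono 3 8
    - mono 4 2 - mono 4 5 + mono 7 0 - mono 7 7 + mono 8 1 + mono 8 4

/-- The polynomial identity `f * g + 1 = T` for the witness (by `ring`-type computation). [folklore] -/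
theorem wf_mul_wg : wf * wg + 1 = wT := by
  simp only [wf, wg, wT, mono]; ring

/-- The 13 exponents of `fg + 1`. [folklore] -/
def wTexps : List (ℕ × ℕ) :=
  [(0,7),(1,4),(1,8),(2,2),(2,5),(3,1),(3,8),(4,2),(4,5),(7,0),(7,7),(8,1),(8,4)]

/-- The support of `T = fg + 1` is contained in the listed 13 exponents. [folklore] -/
theorem mem_wTexps_of_mem_support {m : Fin 2 →₀ ℕ} (hm : m ∈ wT.support) : (m 0, m 1) ∈ wTexps := by
  have hm' : coeff (ex (m 0) (m 1)) wT ≠ 0 := by rw [ex_eta]; exact mem_support_iff.1 hm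
  by_contra hnot
  simp only [wTexps, List.mem_cons, Prod.mk.injEq, List.not_mem_nil, or_false, not_or] at hnot
  obtain ⟨h1, h2, h3, h4, h5, h6, h7, h8, h9, h10, h11, h12, h13⟩ := hnot
  apply hm'
  simp [wT, mono_eq, coeff_monomial, ex_eq_iff, h1, h2, h3, h4, h5, h6, h7, h8, h9, h10, h11, h12, h13]

/-- The support of `f` is contained in its 4 listed exponents. [folklore] -/
theorem mem_wfexps_of_mem_support {m : Fin 2 →₀ ℕ} (hm : m ∈ wf.support) :
    (m 0, m 1) ∈ [(0,0),(1,1),(1,4),(0,7)] := by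
  have hm' : coeff (ex (m 0) (m 1)) wf ≠ 0 := by rw [ex_eta]; exact mem_support_iff.1 hm
  by_contra hnot
  simp only [List.mem_cons, Prod.mk.injEq, List.not_mem_nil, or_false, not_or] at hnot
  obtain ⟨h1, h2, h3, h4⟩ := hnot
  apply hm'
  simp [wf, mono_eq, coeff_monomial, ex_eq_iff, h1, h2, h3, h4]

/-- The support of `g` is contained in its 4 listed exponents. [folklore] -/
theorem mem_wgexps_of_mem_support {m : Fin 2 →₀ ℕ} (hm : m ∈ wg.support) :
    (m 0, m 1) ∈ [(0,0),(1,1),(3,1),(7,0)] := by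
  have hm' : coeff (ex (m 0) (m 1)) wg ≠ 0 := by rw [ex_eta]; exact mem_support_iff.1 hm
  by_contra hnot
  simp only [List.mem_cons, Prod.mk.injEq, List.not_mem_nil, or_false, not_or] at hnot
  obtain ⟨h1, h2, h3, h4⟩ := hnot
  apply hm'
  simp [wg, mono_eq, coeff_monomial, ex_eq_iff, h1, h2, h3, h4]

/-- A support whose coordinate pairs lie in a list has at most `length` elements. [folklore] -/
theorem card_support_le_of_mem_list {p : MvPolynomial (Fin 2) ℂ} (L : List (ℕ × ℕ))
    (h : ∀ m ∈ p.support, (m 0, m 1) ∈ L) : p.support.card ≤ L.length := by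
  classical
  refine (Finset.card_le_card_of_injOn (fun m => (m 0, m 1)) (fun m hm => ?_) ?_).trans
    (List.toFinset_card_le L)
  · exact Finset.mem_coe.2 (List.mem_toFinset.2 (h m (Finset.mem_coe.1 hm)))
  · intro m₁ _ m₂ _ heq
    simp only [Prod.mk.injEq] at heq
    rw [← ex_eta m₁, ← ex_eta m₂]
    exact ex_eq_iff.2 ⟨heq.1.symm, heq.2.symm⟩

/-- `f` is `4`-sparse. [folklore] -/
theorem card_support_wf : wf.support.card ≤ 4 :=
  card_support_le_of_mem_list _ fun _ hm => mem_wfexps_of_mem_support hm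

/-- `g` is `4`-sparse. [folklore] -/
theorem card_support_wg : wg.support.card ≤ 4 :=
  card_support_le_of_mem_list _ fun _ hm => mem_wgexps_of_mem_support hm

/-- The linear functional `(x, y) ↦ α x + β y` on `ℝ²`. [folklore] -/
def linFun (α β : ℝ) : (Fin 2 → ℝ) →ₗ[ℝ] ℝ := α • LinearMap.proj 0 + β • LinearMap.proj 1

/-- Evaluation of `linFun`. [folklore] -/
@[simp] theorem linFun_apply (α β : ℝ) (q : Fin 2 → ℝ) : linFun α β q = α * q 0 + β * q 1 := by
  simp [linFun]

/-- A support point of `fg + 1` strictly exposed by an integer functional is a vertex. [folklore] -/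
theorem toPt_mem_extremePoints {a b : ℕ} (α β : ℤ) (hab : coeff (ex a b) wT ≠ 0)
    (hsep : ∀ p ∈ wTexps, p ≠ (a, b) → α * (p.1 : ℤ) + β * (p.2 : ℤ) < α * (a : ℤ) + β * (b : ℤ)) :
    toPt (ex a b) ∈ (convexHull ℝ (toPt '' (wT.support : Set (Fin 2 →₀ ℕ)))).extremePoints ℝ := by
  refine mem_extremePoints_convexHull_of_linear ⟨ex a b, ?_, rfl⟩ (linFun (α : ℝ) (β : ℝ)) ?_
  · exact Finset.mem_coe.2 (mem_support_iff.2 hab)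
  · rintro q ⟨m, hm, rfl⟩ hne
    have hmem := mem_wTexps_of_mem_support (Finset.mem_coe.1 hm)
    have hne' : (m 0, m 1) ≠ (a, b) := by
      intro h
      apply hne
      simp only [Prod.mk.injEq] at h
      rw [← ex_eta m, h.1, h.2]
    have key := hsep _ hmem hne'
    have key' : (α : ℝ) * ((m 0 : ℕ) : ℝ) + (β : ℝ) * ((m 1 : ℕ) : ℝ) < (α : ℝ) * (a : ℝ) + (β : ℝ) * (b : ℝ) := by
      exact_mod_cast key
    simpa [toPt, ex] using key'

/-- The ten vertices of `Newt(fg + 1)`. [folklore] -/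
def wVerts : List (ℕ × ℕ) := [(0,7),(1,4),(2,2),(3,1),(7,0),(8,1),(8,4),(7,7),(3,8),(1,8)]

/-- Each of the ten listed points is an extreme point of `Newt(fg + 1)` (strict integer separating functional). [folklore] -/
theorem vert_mem (p : ℕ × ℕ) (hp : p ∈ wVerts) :
    toPt (ex p.1 p.2) ∈ (convexHull ℝ (toPt '' (wT.support : Set (Fin 2 →₀ ℕ)))).extremePoints ℝ := by
  simp only [wVerts, List.mem_cons, List.not_mem_nil, or_false] at hp
  rcases hp with rfl | rfl | rfl | rfl | rfl | rfl | rfl | rfl | rfl | rfl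
  · exact toPt_mem_extremePoints (-1) 0
      (by simp [wT, mono_eq, coeff_monomial, ex_eq_iff]) (by decide)
  · exact toPt_mem_extremePoints (-5) (-2)
      (by simp [wT, mono_eq, coeff_monomial, ex_eq_iff]) (by decide)
  · exact toPt_mem_extremePoints (-3) (-2)
      (by simp [wT, mono_eq, coeff_monomial, ex_eq_iff]) (by decide)
  · exact toPt_mem_extremePoints (-1) (-2)
      (by simp [wT, mono_eq, coeff_monomial, ex_eq_iff]) (by decide)
  · exact toPt_mem_extremePoints 0 (-1)
      (by simp [wT, mono_eq, coeff_monomial, ex_eq_iff]) (by decide)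
  · exact toPt_mem_extremePoints 2 (-1)
      (by simp [wT, mono_eq, coeff_monomial, ex_eq_iff]) (by decide)
  · exact toPt_mem_extremePoints 4 1
      (by simp [wT, mono_eq, coeff_monomial, ex_eq_iff]) (by decide)
  · exact toPt_mem_extremePoints 1 1
      (by simp [wT, mono_eq, coeff_monomial, ex_eq_iff]) (by decide)
  · exact toPt_mem_extremePoints 1 5
      (by simp [wT, mono_eq, coeff_monomial, ex_eq_iff]) (by decide)
  · exact toPt_mem_extremePoints (-1) 2
      (by simp [wT, mono_eq, coeff_monomial, ex_eq_iff]) (by decide)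

/-- `Newt(fg + 1)` has at least `10 = 2t + 2` vertices for the `t = 4` witness. [folklore] -/
theorem ten_le_newtonVertexCount_wT : 10 ≤ newtonVertexCount wT := by
  classical
  set E := (convexHull ℝ (toPt '' (wT.support : Set (Fin 2 →₀ ℕ)))).extremePoints ℝ with hE
  have hfin : E.Finite :=
    ((wT.support.finite_toSet).image toPt).subset extremePoints_convexHull_subset
  let φ : ℕ × ℕ → (Fin 2 → ℝ) := fun p => toPt (ex p.1 p.2)
  have hφ : Function.Injective φ := by
    intro p q h
    have h0 := congrArg (fun v => v 0) h
    have h1 := congrArg (fun v => v 1) h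
    simp only [φ, toPt_ex_zero, toPt_ex_one, Nat.cast_inj] at h0 h1
    exact Prod.ext h0 h1
  have hsub : φ '' (wVerts.toFinset : Set (ℕ × ℕ)) ⊆ E := by
    rintro _ ⟨p, hp, rfl⟩
    exact vert_mem p (List.mem_toFinset.1 (Finset.mem_coe.1 hp))
  have hcard : (φ '' (wVerts.toFinset : Set (ℕ × ℕ))).ncard = 10 := by
    rw [Set.ncard_image_of_injective _ hφ, Set.ncard_coe_finset]; rfl
  have h := Set.ncard_le_ncard hsub hfin
  rw [hcard] at h
  exact h

/-- NAIVE SHARP FORM of KPTT problem 1 (the cancellation-free value): `#vert Newt(fg + 1) ≤ 2t + 1`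
for `t`-sparse `f, g`.  REFUTED below by the `t = 4` witness; recorded as an obligation so that the
refutation is a connected negative edge (a planner typing KPTT problem 1 must use `O(t)` / `2t + 2`,
see `FgPlusOneLinear`). -/
@[conjecture] def FgPlusOneTwoTAddOne : Prop :=
  ∀ (t : ℕ) (f g : MvPolynomial (Fin 2) ℂ), f.support.card ≤ t → g.support.card ≤ t →
    newtonVertexCount (f * g + 1) ≤ 2 * t + 1

/-- **Refutation** of the naive sharp form: `f = 1 + XY + XY⁴ - Y⁷`, `g = -1 + XY - X³Y + X⁷` have
`4` monomials each and `Newt(fg + 1)` has `10 > 2·4 + 1` vertices. [folklore] -/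
theorem not_fgPlusOneTwoTAddOne : ¬ FgPlusOneTwoTAddOne := by
  intro h
  have h4 := h 4 wf wg card_support_wf card_support_wg
  rw [wf_mul_wg] at h4
  have h10 := ten_le_newtonVertexCount_wT
  omega

end Summit.ValiantsHypothesis.ValiantsHypothesis.Theorems

end
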